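import Mathlib
import HarnessLib

/-!
# Sly's first-moment sums `E Z^{±}_{G̃}(η)` as explicit functions (vocabulary for Lemma 3.3)

Sly 2010, §3: for the gadget core `G̃ = G̃(n, θ, ψ)` (halves `W^{±} ∪ U^{±} = [n] ⊔ [m']`, `d - 1 = k`
uniform perfect matchings of the halves and one of `W⁺` with `W⁻`) and a boundary configuration
`η` on `U` occupying `η⁺` vertices of `U⁺` and `η⁻` of `U⁻`, the expected restricted partition
functions are explicit finite sums of products of binomial coefficients
(`Literature.Computability.Complexity.sly_firstMoment`, eq. (e:gtEZ1)):
`E Z^{a,b}_{G̃}(η) = λ^{a+b+η⁺+η⁻} C(n,a) C(n,b) [C(n+m'-b-η⁻, a+η⁺)/C(n+m', a+η⁺)]^k C(n-b,a)/C(n,a)`,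
and `E Z^{±}_{G̃}(η) = Σ_{a ≥ b} E Z^{a,b}_{G̃}(η)`, resp. `Σ_{a < b}` (the phase is `+` iff the
configuration occupies at least as many vertices of `W⁺` as of `W⁻`). This file only NAMES these
real-valued functions of the sizes — `slyF`, `mwwF` (the Mossel–Weitz–Wormald analogue, `d = k+1`
matchings of `[n]`), `slyZplus`, `slyZminus`, `mwwZplus` — so that Sly's Lemma 3.3 and its proof
(`HardcoreInapproximabilityFirstMoment.lean` and sequels) can be stated readably; it proves only
their unfolding lemmas, nonnegativity, and vanishing for `a + b > n`. No `Prop`-valued facts.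

## References

* A. Sly, *Computational transition at the uniqueness threshold*, FOCS 2010, arXiv:1005.5584, §3
  (the definitions of `Z^{α,β}_{G̃}(η)`, `Z^{±}_{G̃}(η)`, `Z^{±}_{G̃}` before Lemma 3.3; eq. (e:gtEZ1))
  [Sly2010].
-/

namespace Literature.Computability.Complexity

open Finset

/-- **`E Z^{a,b}_{G̃}(η)` as a function of the sizes** (Sly's eq. (e:gtEZ1), the right-hand side of
`sly_firstMoment` with `k = d - 1`, `m'` extra vertices per side, `η⁺ = ep`, `η⁻ = em`):
`λ^{a+b+η⁺+η⁻} C(n,a) C(n,b) [C(n+m'-(b+η⁻), a+η⁺)/C(n+m', a+η⁺)]^k · C(n-b,a)/C(n,a)`.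
[cite: Sly2010, proof of Lemma 3.1, eq. (e:gtEZ1)] -/
noncomputable def slyF (n m' k : ℕ) (lam : ℝ) (a b ep em : ℕ) : ℝ :=
  lam ^ (a + b + ep + em) * (n.choose a) * (n.choose b) *
    (((n + m' - (b + em)).choose (a + ep) : ℝ) / ((n + m').choose (a + ep))) ^ k *
    (((n - b).choose a : ℝ) / (n.choose a))

/-- **`E Z^{a,b}_{MWW}` as a function of the sizes** (the right-hand side of `mww_firstMoment` with
`d = k + 1` matchings): `λ^{a+b} C(n,a) C(n,b) [C(n-b,a)/C(n,a)]^{k+1}`.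
[cite: Sly2010, proof of Lemma 3.1 (the display for `Z^{α,β}_{MWW}`)] -/
noncomputable def mwwF (n k : ℕ) (lam : ℝ) (a b : ℕ) : ℝ :=
  lam ^ (a + b) * (n.choose a) * (n.choose b) * (((n - b).choose a : ℝ) / (n.choose a)) ^ (k + 1)

/-- **`E Z⁺_{G̃}(η) = Σ_{a ≥ b} E Z^{a,b}_{G̃}(η)`** (phase `+`: at least as many occupied vertices in
`W⁺` as in `W⁻`; terms with `a + b > n` vanish). [cite: Sly2010, §3 (definition of `Z⁺_{G̃}(η)` before Lemma 3.3)] -/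
noncomputable def slyZplus (n m' k : ℕ) (lam : ℝ) (ep em : ℕ) : ℝ :=
  ∑ a ∈ range (n + 1), ∑ b ∈ range (a + 1), slyF n m' k lam a b ep em

/-- **`E Z⁻_{G̃}(η) = Σ_{a < b} E Z^{a,b}_{G̃}(η)`** (phase `-`). [cite: Sly2010, §3 (definition of `Z⁻_{G̃}(η)` before Lemma 3.3)] -/
noncomputable def slyZminus (n m' k : ℕ) (lam : ℝ) (ep em : ℕ) : ℝ :=
  ∑ a ∈ range (n + 1), ∑ b ∈ Ioc a n, slyF n m' k lam a b ep em

/-- **`E Z⁺_{MWW} = Σ_{a ≥ b} E Z^{a,b}_{MWW}`**. [cite: Sly2010, proof of Lemma 3.3 ("where `E Z⁺_{MWW}` denotes `Σ_{α ≥ β} E Z^{α,β}_{MWW}`")] -/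
noncomputable def mwwZplus (n k : ℕ) (lam : ℝ) : ℝ :=
  ∑ a ∈ range (n + 1), ∑ b ∈ range (a + 1), mwwF n k lam a b

/-- Unfolding lemma for `slyF`. [cite: Sly2010, eq. (e:gtEZ1)] -/
theorem slyF_def (n m' k : ℕ) (lam : ℝ) (a b ep em : ℕ) :
    slyF n m' k lam a b ep em =
      lam ^ (a + b + ep + em) * (n.choose a) * (n.choose b) *
        (((n + m' - (b + em)).choose (a + ep) : ℝ) / ((n + m').choose (a + ep))) ^ k *
        (((n - b).choose a : ℝ) / (n.choose a)) := rfl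

/-- Unfolding lemma for `mwwF`. [cite: Sly2010, proof of Lemma 3.1 (display for `Z^{α,β}_{MWW}`)] -/
theorem mwwF_def (n k : ℕ) (lam : ℝ) (a b : ℕ) :
    mwwF n k lam a b =
      lam ^ (a + b) * (n.choose a) * (n.choose b) * (((n - b).choose a : ℝ) / (n.choose a)) ^ (k + 1) := rfl

/-- Unfolding lemma for `slyZplus`. [cite: Sly2010, §3 (definition of `Z⁺_{G̃}(η)`)] -/
theorem slyZplus_def (n m' k : ℕ) (lam : ℝ) (ep em : ℕ) :
    slyZplus n m' k lam ep em = ∑ a ∈ range (n + 1), ∑ b ∈ range (a + 1), slyF n m' k lam a b ep em := rfl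

/-- Unfolding lemma for `slyZminus`. [cite: Sly2010, §3 (definition of `Z⁻_{G̃}(η)`)] -/
theorem slyZminus_def (n m' k : ℕ) (lam : ℝ) (ep em : ℕ) :
    slyZminus n m' k lam ep em = ∑ a ∈ range (n + 1), ∑ b ∈ Ioc a n, slyF n m' k lam a b ep em := rfl

/-- Unfolding lemma for `mwwZplus`. [cite: Sly2010, proof of Lemma 3.3] -/
theorem mwwZplus_def (n k : ℕ) (lam : ℝ) :
    mwwZplus n k lam = ∑ a ∈ range (n + 1), ∑ b ∈ range (a + 1), mwwF n k lam a b := rfl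

/-- `slyF ≥ 0` for `λ ≥ 0`. [folklore] -/
theorem slyF_nonneg (n m' k : ℕ) {lam : ℝ} (hlam : 0 ≤ lam) (a b ep em : ℕ) :
    0 ≤ slyF n m' k lam a b ep em := by
  unfold slyF; positivity

/-- `mwwF ≥ 0` for `λ ≥ 0`. [folklore] -/
theorem mwwF_nonneg (n k : ℕ) {lam : ℝ} (hlam : 0 ≤ lam) (a b : ℕ) : 0 ≤ mwwF n k lam a b := by
  unfold mwwF; positivity

/-- `slyF = 0` when `a + b > n` (the small matching cannot avoid `S × T`: `C(n-b, a) = 0`). [folklore] -/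
theorem slyF_eq_zero_of_lt (n m' k : ℕ) (lam : ℝ) {a b : ℕ} (h : n < a + b) (ep em : ℕ) :
    slyF n m' k lam a b ep em = 0 := by
  unfold slyF
  rcases Nat.eq_zero_or_pos a with rfl | ha
  · rw [Nat.choose_eq_zero_of_lt (show n < b by omega)]
    simp
  · rw [Nat.choose_eq_zero_of_lt (by omega : n - b < a)]
    simp

/-- `mwwF = 0` when `a + b > n`. [folklore] -/
theorem mwwF_eq_zero_of_lt (n k : ℕ) (lam : ℝ) {a b : ℕ} (h : n < a + b) : mwwF n k lam a b = 0 := by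
  unfold mwwF
  rcases Nat.eq_zero_or_pos a with rfl | ha
  · rw [Nat.choose_eq_zero_of_lt (show n < b by omega)]
    simp
  · rw [Nat.choose_eq_zero_of_lt (by omega : n - b < a)]
    simp

/-- `slyZplus ≥ 0` for `λ ≥ 0`. [folklore] -/
theorem slyZplus_nonneg (n m' k : ℕ) {lam : ℝ} (hlam : 0 ≤ lam) (ep em : ℕ) :
    0 ≤ slyZplus n m' k lam ep em :=
  sum_nonneg fun _ _ => sum_nonneg fun _ _ => slyF_nonneg n m' k hlam _ _ _ _

end Literature.Computability.Complexity
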